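import Literature.AlgebraicGeometry.Frobenioids.Thm49AsPrinted
import Literature.AlgebraicGeometry.Frobenioids.Cor411AsPrinted
import Literature.AlgebraicGeometry.Frobenioids.Cor411iAsPrinted
import Literature.AlgebraicGeometry.Frobenioids.Thm49Padic
import Literature.AlgebraicGeometry.Frobenioids.Cor411Padic
import Literature.AlgebraicGeometry.Frobenioids.PadicFrobenioidRationallyStandard
import Literature.AlgebraicGeometry.Frobenioids.PadicFrobenioidStandardTypeUnconditional
import HarnessLib

/-!
# Frobenioids I, Theorem 4.9 and Corollary 4.11 at the `p`-adic Frobenioids of [FrdII] Example 1.1 —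
# in the generality of [FrdII] Theorem 1.2 (i): bases of FSMFF-type, `Φ`, `B` monoids on `D`

Mochizuki, *The geometry of Frobenioids I: the general theory*, Kyushu J. Math. **62** (2008) 293–400, kurims
text: Theorem 4.9 p. 88 l. 36 – p. 89 l. 2 (category-theoreticity of the divisor monoid)
[cite: MochizukiFrdI2008, Thm. 4.9 p.88], Corollary 4.11 pp. 91–92 (category-theoreticity of the base category, of
the divisor monoid over it and of the functor to the elementary Frobenioid) [cite: MochizukiFrdI2008, Cor. 4.11 p.91];
applied at Mochizuki, *The geometry of Frobenioids II: poly-Frobenioids*, Kyushu J. Math. **62** (2008) 401–460,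
Example 1.1 (ii) p. 8 (the `p`-adic Frobenioid `C` of a datum `(D → D₀, Φ ⊆ Φ₀|_D, B → Φ^gp)`, "a monoprime [cf.
[Mzk5], §0; the convention of [Mzk5], Definition 1.1, (ii)] subfunctor in monoids") and Theorem 1.2 (i) p. 9, third
sentence VERBATIM: "If `D` is of FSMFF-type, then `C` is of rationally standard type"
[cite: MochizukiFrdII2008, Ex 1.1 (ii) p.8] [cite: MochizukiFrdII2008, Thm 1.2 (i) p.9].

PROOF-ONLY file (abc-iut cell, block F fact-proving wave, seat abc-iut-f-027 gen 2; node FrdI:Thm4.9 / FrdI:Cor4.11,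
genuine-data instances at the LOCAL Frobenioids), 0 definitions. Companion of seat abc-iut-w4-d109's
`Thm49Padic.lean` / `Cor411Padic.lean`, whose every theorem carries "`D_i` of FSM-type" — a hypothesis STRONGER than
print's: [FrdII] Thm. 1.2 (i) asks only "`D` of FSMFF-type" (FSM-type ⇒ FSMFF-type, `IsOfFSMType.isOfFSMFFType`),
together with the standing convention of Ex. 1.1 (ii) that `Φ`, `B` are MONOIDS ON `D` in the sense of [FrdI]
Def. 1.1 (ii) (`PadicFrd.Datum.IsMonoidData`; automatic over FSM-type bases, `isMonoidData_of_isOfFSMType`). The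
FSM hypothesis was forced by the cell's earlier closers of Thm. 4.9 / Cor. 4.11, which consumed [FrdI] Thm. 3.4 (ii)
over FSM-type bases only. Since `Thm49AsPrinted.lean` (f-027 gen 0: `FrdI.T49.thm49_ofFunctor`,
`exists_thm49_compat_ofFunctor`) and `Cor411AsPrinted.lean` / `Cor411iAsPrinted.lean` (abc-iut-L1-d6:
`FrdI.cor411ii/iii/iv_ofFunctor`, `exists_cor411iv_data_ofFunctor`, `PreFrobenioid.cor411i_ofFunctor`) the typed
Thm. 4.9 and Cor. 4.11 hold for EVERY pair of Frobenioids with perf-factorial `Φ_i`, NO hypothesis on the bases.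
Hence, at a pair of `p`-adic Frobenioid data `d_i : PadicFrd.Datum D_i p_i` (primes `p₁`, `p₂` arbitrary):

* with ONLY print's convention `d_i.IsMonoidData` (so that "`C_i` is a Frobenioid", [FrdI] Thm. 5.2 (ii),
  `isFrobenioid_of_isMonoidData`): the TYPED statements — `PadicFrd.thm49_padic_rsParams_of_isMonoidData` /
  `thm49_padic_of_isMonoidData` (`PreFrobenioidData.Thm49` at any / THE Def. 4.5 (iii) parameters),
  `cor411ii_padic_of_isMonoidData`, `cor411iii_padic_of_isMonoidData`, `cor411iv_padic_of_isMonoidData` — their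
  remaining inputs being theorems: `Φ_i` perf-factorial (monoprime, `padic_objectwise_isPerfFactorial`) and "`C₁` of
  rational type" at THE birationalization / primary support (`Datum.padic_isRational_rsParams`, [FrdII] Thm. 1.2 (i)
  "[strictly] rational type");
* with print's "`D_i` of FSMFF-type" on top (the antecedents then being [FrdII] Thm. 1.2 (i):
  `Datum.isOfRationallyStandardType_rsParams`, `thm12_isOfStandardType_of_isOfFSMFFType`): the CONCLUSIONS outright —
  `nonempty_divisorMonoidIsoOver_padic_of_isOfFSMFFType` (**for every `Ψ : C₁ ⥲ C₂` an isomorphism of functors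
  `Ψ^Φ : Φ₁ ⥲ Φ₂` lying over `Ψ`**), `exists_thm49_compat_padic_of_isOfFSMFFType` (the compatibility clause with THE
  `Ψ^Prime` of Thm. 4.2 (ii)), and, over SLIM bases (Cor. 4.11's "`D_i` Div-slim", Def. 4.5 (iv)),
  `exists_oneUniqueSquare_base_padic_of_isOfFSMFFType` (Cor. 4.11 (ii): `1`-unique `Ψ^Base`),
  `exists_divisorTransport_padic_of_isOfFSMFFType` ((iii): `Ψ^Φ` over `Ψ^Base`),
  `exists_cor411iv_data_padic_of_isOfFSMFFType` ((iv): the `1`-commutative diagram with `F_{Φ_i}`),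
  `exists_cor411i_padic_of_isOfFSMFFType` ((i): `Ψ^istr`, `Ψ^un-tr`).

Each statement is the FSM-base statement of `Thm49Padic.lean` / `Cor411Padic.lean` verbatim with `IsOfFSMType D_i`
replaced by print's weaker pair; no statement of either paper is restated or strengthened; no new definition;
nothing here bears on, or takes a side on, [IUTchIII] Cor. 3.12 (typed ≠ proved elsewhere; here proved =
kernel-checked).
-/

noncomputable section

namespace Literature.AlgebraicGeometry.Frobenioids

open CategoryTheory Opposite
open PreFrobenioid PreFrobenioidData

namespace PadicFrd

universe v u

variable {D₁ : Type u} [Category.{v} D₁] {D₂ : Type u} [Category.{v} D₂]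
variable {p₁ p₂ : ℕ} [Fact p₁.Prime] [Fact p₂.Prime]
variable (d₁ : Datum D₁ p₁) (d₂ : Datum D₂ p₂)

/-! ### The inputs of the base-hypothesis-free closers at a `p`-adic Frobenioid -/

/-- **"`C` is of rational type" READ AT THE CONSTRUCTIONS, with only `Φ`, `B` monoids on `D`** ([FrdII] Thm. 1.2
(i) "[strictly] rational type", p. 9): every object of the `p`-adic Frobenioid is rational ([FrdI] Def. 4.5 (ii))
at THE birationalization and the primary support of Def. 2.4 (i)(d) — the binder `hrat₁` of the cell's Thm. 4.9 /
Cor. 4.11 closers (abc-iut-L1-d10 lineage `Datum.padic_isRational_rsParams`, no base hypothesis).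
[cite: MochizukiFrdII2008, Thm 1.2 (i) p.9] -/
theorem padic_isRational_biratData_of_isMonoidData (h₁ : d₁.IsMonoidData) (A : d₁.frobenioid) :
    PreFrobenioidData.IsRational
      (biratData (d₁.isFrobenioid_of_isMonoidData h₁)
        (hasBiratSquares_of_isFrobenioid (d₁.isFrobenioid_of_isMonoidData h₁)))
      (S := ModelFrobenioid.data d₁.Φ d₁.B d₁.divB) (fun a 𝔭 => PrimarySupp a 𝔭) A :=
  d₁.padic_isRational_rsParams h₁ A

/-- The hypotheses of the compatibility clause of Thm. 4.9 (`Thm42Setting`: standard type, isotropic type, not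
of group-like type) HOLD for every pair of `p`-adic Frobenioids over bases of FSMFF-type — [FrdII] Thm. 1.2 (i),
the standard-type half for EVERY datum (abc-iut-f-047's `thm12_isOfStandardType_of_isOfFSMFFType`).
[cite: MochizukiFrdII2008, Thm 1.2 (i) p.9] -/
theorem thm42Setting_padic_of_isOfFSMFFType (hD₁ : IsOfFSMFFType D₁) (hD₂ : IsOfFSMFFType D₂) :
    Thm42Setting (ModelFrobenioid.data d₁.Φ d₁.B d₁.divB) (ModelFrobenioid.data d₂.Φ d₂.B d₂.divB) where
  standard := ⟨d₁.thm12_isOfStandardType_of_isOfFSMFFType hD₁, d₂.thm12_isOfStandardType_of_isOfFSMFFType hD₂⟩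
  isotropic := ⟨ModelFrobenioid.data_isOfIsotropicType d₁.objectwise_isGroupLike_B,
    ModelFrobenioid.data_isOfIsotropicType d₂.objectwise_isGroupLike_B⟩
  notGroupLike := ⟨padic_not_isOfGroupLikeType d₁, padic_not_isOfGroupLikeType d₂⟩

/-- **The standing hypotheses of [FrdI] Cor. 4.11 HOLD for every equivalence `Ψ : C₁ ⥲ C₂` between `p`-adic
Frobenioids over SLIM bases of FSMFF-type**: `D_i` Div-slim (slim ⇒ Div-slim, Def. 4.5 (iv)), `C_i` of standard
type ([FrdII] Thm. 1.2 (i), for every datum), hypothesis (b) idle (a `p`-adic Frobenioid is not of group-like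
type). [cite: MochizukiFrdI2008, Cor. 4.11 p.91] [cite: MochizukiFrdII2008, Thm 1.2 (i) p.9] -/
theorem cor411Setting_padic_of_isOfFSMFFType (hD₁ : IsOfFSMFFType D₁) (hD₂ : IsOfFSMFFType D₂)
    (hsl₁ : IsSlim D₁) (hsl₂ : IsSlim D₂) (Ψ : d₁.frobenioid ≌ d₂.frobenioid) :
    (ModelFrobenioid.data d₁.Φ d₁.B d₁.divB).Cor411Setting (ModelFrobenioid.data d₂.Φ d₂.B d₂.divB) Ψ where
  divSlim := ⟨PreFrobenioidData.isDivSlim_of_isSlim _ hsl₁, PreFrobenioidData.isDivSlim_of_isSlim _ hsl₂⟩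
  standard := ⟨d₁.thm12_isOfStandardType_of_isOfFSMFFType hD₁, d₂.thm12_isOfStandardType_of_isOfFSMFFType hD₂⟩
  hypB h _ := absurd h (padic_not_isOfGroupLikeType d₁)

/-! ### Theorem 4.9 — the typed statement needs only `Φ`, `B` monoids on `D` -/

/-- **[FrdI] Thm. 4.9 AS TYPED (`PreFrobenioidData.Thm49`) for a pair of `p`-adic Frobenioids with `Φ_i`, `B_i`
monoids on `D_i`, any equivalence `Ψ` and ANY Def. 4.5 (iii) parameters `R₁, R₂` — NO hypothesis on the base
categories** (f-027's `FrdI.T49.thm49_ofFunctor`; the typed statement carries "`C_i` of rationally standard type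
at `R_i`" as its own antecedent). [cite: MochizukiFrdI2008, Thm. 4.9 p.88] -/
theorem thm49_padic_rsParams_of_isMonoidData (h₁ : d₁.IsMonoidData) (h₂ : d₂.IsMonoidData)
    (Ψ : d₁.frobenioid ≌ d₂.frobenioid)
    (R₁ : (ModelFrobenioid.data d₁.Φ d₁.B d₁.divB).RSParams)
    (R₂ : (ModelFrobenioid.data d₂.Φ d₂.B d₂.divB).RSParams) :
    (ModelFrobenioid.data d₁.Φ d₁.B d₁.divB).Thm49 (ModelFrobenioid.data d₂.Φ d₂.B d₂.divB) Ψ R₁ R₂ :=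
  FrdI.T49.thm49_ofFunctor (d₁.isFrobenioid_of_isMonoidData h₁) (d₂.isFrobenioid_of_isMonoidData h₂)
    (padic_objectwise_isPerfFactorial d₁) (padic_objectwise_isPerfFactorial d₂)
    (padic_isRational_biratData_of_isMonoidData d₁ h₁) Ψ R₁ R₂

/-- **[FrdI] Thm. 4.9 AS TYPED at THE Def. 4.5 (iii) parameters** of two `p`-adic Frobenioids with `Φ_i`, `B_i`
monoids on `D_i` (support = the primary support of Def. 2.4 (i)(d)); no base hypothesis.
[cite: MochizukiFrdI2008, Thm. 4.9 p.88] -/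
theorem thm49_padic_of_isMonoidData (h₁ : d₁.IsMonoidData) (h₂ : d₂.IsMonoidData)
    (Ψ : d₁.frobenioid ≌ d₂.frobenioid) :
    (ModelFrobenioid.data d₁.Φ d₁.B d₁.divB).Thm49 (ModelFrobenioid.data d₂.Φ d₂.B d₂.divB) Ψ
      (rsParams (d₁.isFrobenioid_of_isMonoidData h₁) fun a 𝔭 => PrimarySupp a 𝔭)
      (rsParams (d₂.isFrobenioid_of_isMonoidData h₂) fun a 𝔭 => PrimarySupp a 𝔭) :=
  thm49_padic_rsParams_of_isMonoidData d₁ d₂ h₁ h₂ Ψ _ _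

/-- **The conclusion of [FrdI] Thm. 4.9 at the `p`-adic Frobenioids, in the generality of [FrdII] Thm. 1.2 (i)**:
for `p`-adic Frobenioid data over bases `D_i` OF FSMFF-TYPE with `Φ_i`, `B_i` monoids on `D_i`, and EVERY
equivalence of categories `Ψ : C₁ ⥲ C₂`, there is an isomorphism of functors `Ψ^Φ : Φ₁ ⥲ Φ₂` lying over `Ψ` —
the antecedents "`C_i` of rationally standard type" being [FrdII] Thm. 1.2 (i) at THE parameters
(`Datum.isOfRationallyStandardType_rsParams`). [cite: MochizukiFrdI2008, Thm. 4.9 p.88]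
[cite: MochizukiFrdII2008, Thm 1.2 (i) p.9] -/
theorem nonempty_divisorMonoidIsoOver_padic_of_isOfFSMFFType (h₁ : d₁.IsMonoidData) (h₂ : d₂.IsMonoidData)
    (hD₁ : IsOfFSMFFType D₁) (hD₂ : IsOfFSMFFType D₂) (Ψ : d₁.frobenioid ≌ d₂.frobenioid) :
    Nonempty (DivisorMonoidIsoOver (ModelFrobenioid.data d₁.Φ d₁.B d₁.divB)
      (ModelFrobenioid.data d₂.Φ d₂.B d₂.divB) Ψ) :=
  thm49_padic_of_isMonoidData d₁ d₂ h₁ h₂ Ψ (d₁.isOfRationallyStandardType_rsParams h₁ hD₁)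
    (d₂.isOfRationallyStandardType_rsParams h₂ hD₂)

/-- **The typed compatibility clause `Thm49_compat` is inhabited at the `p`-adic Frobenioids over bases of
FSMFF-type with `Φ_i`, `B_i` monoids on `D_i`**: for every `Ψ : C₁ ⥲ C₂` there are an isomorphism of functors `Ψ^Φ`
over `Ψ` computing `Div(Ψ φ) = Ψ^Φ_A(Div φ)` on pre-steps and THE `Ψ^Prime` of Thm. 4.2 (ii) such that `Ψ^Φ_A`
carries `Φ₁(A)_𝔭` onto `Φ₂(Ψ A)_{Ψ^Prime 𝔭}` ([FrdI] Thm. 4.9 p. 89 ll. 1–2; the `C_i` isotropic, standard,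
non-group-like by [FrdII] Thm. 1.2 (i)). [cite: MochizukiFrdI2008, Thm. 4.9 p.89]
[cite: MochizukiFrdII2008, Thm 1.2 (i) p.9] -/
theorem exists_thm49_compat_padic_of_isOfFSMFFType (h₁ : d₁.IsMonoidData) (h₂ : d₂.IsMonoidData)
    (hD₁ : IsOfFSMFFType D₁) (hD₂ : IsOfFSMFFType D₂) (Ψ : d₁.frobenioid ≌ d₂.frobenioid) :
    ∃ (E : DivisorMonoidIsoOver (ModelFrobenioid.data d₁.Φ d₁.B d₁.divB)
        (ModelFrobenioid.data d₂.Φ d₂.B d₂.divB) Ψ)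
      (e : ∀ A : d₁.frobenioid,
        Primes ((ModelFrobenioid.data d₁.Φ d₁.B d₁.divB).Mon
            ((ModelFrobenioid.data d₁.Φ d₁.B d₁.divB).base.obj A)) ≃
          Primes ((ModelFrobenioid.data d₂.Φ d₂.B d₂.divB).Mon
            ((ModelFrobenioid.data d₂.Φ d₂.B d₂.divB).base.obj (Ψ.functor.obj A)))),
      (∀ ⦃A B : d₁.frobenioid⦄ (φ : A ⟶ B), IsPreStep d₁.structureFunctor φ →
          E.iso A (Div d₁.structureFunctor φ) = Div d₂.structureFunctor (Ψ.functor.map φ)) ∧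
      (ModelFrobenioid.data d₁.Φ d₁.B d₁.divB).Thm49_compat (ModelFrobenioid.data d₂.Φ d₂.B d₂.divB) Ψ E e := by
  obtain ⟨E, e, -, hdiv, h⟩ := FrdI.T49.exists_thm49_compat_ofFunctor
    (d₁.isFrobenioid_of_isMonoidData h₁) (d₂.isFrobenioid_of_isMonoidData h₂)
    (padic_objectwise_isPerfFactorial d₁) (padic_objectwise_isPerfFactorial d₂)
    (padic_isRational_biratData_of_isMonoidData d₁ h₁) Ψ (thm42Setting_padic_of_isOfFSMFFType d₁ d₂ hD₁ hD₂)
  exact ⟨E, e, hdiv, h⟩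

/-! ### Corollary 4.11 (ii) -/

/-- **[FrdI] Cor. 4.11 (ii) AS TYPED for every equivalence `Ψ : C₁ ⥲ C₂` of `p`-adic Frobenioids with `Φ_i`, `B_i`
monoids on `D_i` — NO hypothesis on the bases** (abc-iut-L1-d6's `FrdI.cor411ii_ofFunctor`; `Φ_i` perf-factorial
since monoprime; the typed statement carries `Cor411Setting` as its antecedent).
[cite: MochizukiFrdI2008, Cor. 4.11 (ii) p.91] -/
theorem cor411ii_padic_of_isMonoidData (h₁ : d₁.IsMonoidData) (h₂ : d₂.IsMonoidData)
    (Ψ : d₁.frobenioid ≌ d₂.frobenioid) :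
    (ModelFrobenioid.data d₁.Φ d₁.B d₁.divB).Cor411ii (ModelFrobenioid.data d₂.Φ d₂.B d₂.divB) Ψ :=
  FrdI.cor411ii_ofFunctor (d₁.isFrobenioid_of_isMonoidData h₁) (d₂.isFrobenioid_of_isMonoidData h₂) Ψ
    (padic_objectwise_isPerfFactorial d₁) (padic_objectwise_isPerfFactorial d₂)

/-- **The `1`-unique `Ψ^Base : D₁ ⥲ D₂` induced by `Ψ`** (Cor. 4.11 (ii) p. 91), for `p`-adic Frobenioids over
slim bases of FSMFF-type with `Φ_i`, `B_i` monoids on `D_i`: for every `Ψ : C₁ ⥲ C₂` there is `Ψ^Base` with a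
`1`-unique `1`-commutative square over the base functors, and the composites `C₁ → D₂` are rigid.
[cite: MochizukiFrdI2008, Cor. 4.11 (ii) p.91] [cite: MochizukiFrdII2008, Thm 1.2 (i) p.9] -/
theorem exists_oneUniqueSquare_base_padic_of_isOfFSMFFType (h₁ : d₁.IsMonoidData) (h₂ : d₂.IsMonoidData)
    (hD₁ : IsOfFSMFFType D₁) (hD₂ : IsOfFSMFFType D₂) (hsl₁ : IsSlim D₁) (hsl₂ : IsSlim D₂)
    (Ψ : d₁.frobenioid ≌ d₂.frobenioid) :
    ∃ ΨBase : D₁ ⥤ D₂,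
      OneUniqueSquare Ψ.functor (ModelFrobenioid.data d₁.Φ d₁.B d₁.divB).base
          (ModelFrobenioid.data d₂.Φ d₂.B d₂.divB).base ΨBase ∧
        IsRigidFunctor (Ψ.functor ⋙ (ModelFrobenioid.data d₂.Φ d₂.B d₂.divB).base) ∧
          IsRigidFunctor ((ModelFrobenioid.data d₁.Φ d₁.B d₁.divB).base ⋙ ΨBase) := by
  obtain ⟨ΨBase, hsq, hrig⟩ := cor411ii_padic_of_isMonoidData d₁ d₂ h₁ h₂ Ψ
    (cor411Setting_padic_of_isOfFSMFFType d₁ d₂ hD₁ hD₂ hsl₁ hsl₂ Ψ)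
  exact ⟨ΨBase, hsq, hrig hsl₁ hsl₂⟩

/-! ### Corollary 4.11 (iii) -/

/-- **[FrdI] Cor. 4.11 (iii) AS TYPED, at ANY Def. 4.5 (iii) parameters, for every equivalence of `p`-adic
Frobenioids with `Φ_i`, `B_i` monoids on `D_i` — NO hypothesis on the bases** (abc-iut-L1-d6's
`FrdI.cor411iii_ofFunctor`; rationality binder = [FrdII] Thm. 1.2 (i) "[strictly] rational type").
[cite: MochizukiFrdI2008, Cor. 4.11 (iii) p.92] -/
theorem cor411iii_padic_of_isMonoidData (h₁ : d₁.IsMonoidData) (h₂ : d₂.IsMonoidData)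
    (Ψ : d₁.frobenioid ≌ d₂.frobenioid) (R₁ : (ModelFrobenioid.data d₁.Φ d₁.B d₁.divB).RSParams)
    (R₂ : (ModelFrobenioid.data d₂.Φ d₂.B d₂.divB).RSParams) :
    (ModelFrobenioid.data d₁.Φ d₁.B d₁.divB).Cor411iii (ModelFrobenioid.data d₂.Φ d₂.B d₂.divB) Ψ R₁ R₂ :=
  FrdI.cor411iii_ofFunctor (d₁.isFrobenioid_of_isMonoidData h₁) (d₂.isFrobenioid_of_isMonoidData h₂)
    (padic_objectwise_isPerfFactorial d₁) (padic_objectwise_isPerfFactorial d₂)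
    (padic_isRational_biratData_of_isMonoidData d₁ h₁) Ψ R₁ R₂

/-- **The conclusion of [FrdI] Cor. 4.11 (iii) outright — the divisor-monoid transport over the base — for `p`-adic
Frobenioids over slim bases of FSMFF-type with `Φ_i`, `B_i` monoids on `D_i`**: for every `Ψ : C₁ ⥲ C₂` there are
a `1`-unique `Ψ^Base : D₁ ⥲ D₂` and an isomorphism of functors `Ψ^Φ : Φ₁ ⥲ Φ₂` lying over `Ψ^Base` (the antecedents
being `cor411Setting_padic_of_isOfFSMFFType` and [FrdII] Thm. 1.2 (i) at THE parameters).
[cite: MochizukiFrdI2008, Cor. 4.11 (iii) p.92] [cite: MochizukiFrdII2008, Thm 1.2 (i) p.9] -/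
theorem exists_divisorTransport_padic_of_isOfFSMFFType (h₁ : d₁.IsMonoidData) (h₂ : d₂.IsMonoidData)
    (hD₁ : IsOfFSMFFType D₁) (hD₂ : IsOfFSMFFType D₂) (hsl₁ : IsSlim D₁) (hsl₂ : IsSlim D₂)
    (Ψ : d₁.frobenioid ≌ d₂.frobenioid) :
    ∃ ΨBase : D₁ ⥤ D₂,
      OneUniqueSquare Ψ.functor (ModelFrobenioid.data d₁.Φ d₁.B d₁.divB).base
          (ModelFrobenioid.data d₂.Φ d₂.B d₂.divB).base ΨBase ∧
        Nonempty (DivisorMonoidIsoOverBase (ModelFrobenioid.data d₁.Φ d₁.B d₁.divB)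
          (ModelFrobenioid.data d₂.Φ d₂.B d₂.divB) ΨBase) :=
  cor411iii_padic_of_isMonoidData d₁ d₂ h₁ h₂ Ψ _ _
    (cor411Setting_padic_of_isOfFSMFFType d₁ d₂ hD₁ hD₂ hsl₁ hsl₂ Ψ)
    (d₁.isOfRationallyStandardType_rsParams h₁ hD₁) (d₂.isOfRationallyStandardType_rsParams h₂ hD₂)

/-! ### Corollary 4.11 (iv) -/

/-- **[FrdI] Cor. 4.11 (iv) AS TYPED, at ANY parameters, for every equivalence of `p`-adic Frobenioids with
`Φ_i`, `B_i` monoids on `D_i` — NO hypothesis on the bases** (abc-iut-L1-d6's `FrdI.cor411iv_ofFunctor`).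
[cite: MochizukiFrdI2008, Cor. 4.11 (iv) p.92] -/
theorem cor411iv_padic_of_isMonoidData (h₁ : d₁.IsMonoidData) (h₂ : d₂.IsMonoidData)
    (Ψ : d₁.frobenioid ≌ d₂.frobenioid) (R₁ : (ModelFrobenioid.data d₁.Φ d₁.B d₁.divB).RSParams)
    (R₂ : (ModelFrobenioid.data d₂.Φ d₂.B d₂.divB).RSParams) :
    (ModelFrobenioid.data d₁.Φ d₁.B d₁.divB).Cor411iv (ModelFrobenioid.data d₂.Φ d₂.B d₂.divB) Ψ R₁ R₂ :=
  FrdI.cor411iv_ofFunctor (d₁.isFrobenioid_of_isMonoidData h₁) (d₂.isFrobenioid_of_isMonoidData h₂)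
    (padic_objectwise_isPerfFactorial d₁) (padic_objectwise_isPerfFactorial d₂)
    (padic_isRational_biratData_of_isMonoidData d₁ h₁) Ψ R₁ R₂

/-- **The conclusion of [FrdI] Cor. 4.11 (iv) outright for `p`-adic Frobenioids over slim bases of FSMFF-type with
`Φ_i`, `B_i` monoids on `D_i`** (category-theoreticity of the functor `C → F_Φ`): for every `Ψ : C₁ ⥲ C₂` there are
an equivalence `Ψ^Base`, `Ψ^Φ` over it and `η : Base₂ ∘ Ψ ≅ Ψ^Base ∘ Base₁`, with `Ψ` preserving Frobenius degrees
and `Div(Ψ φ) = η_A^* Ψ^Φ(Div φ)` for every arrow `φ` of `C₁`; the `D₂`-valued composites are rigid.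
[cite: MochizukiFrdI2008, Cor. 4.11 (iv) p.92] [cite: MochizukiFrdII2008, Thm 1.2 (i) p.9] -/
theorem exists_cor411iv_data_padic_of_isOfFSMFFType (h₁ : d₁.IsMonoidData) (h₂ : d₂.IsMonoidData)
    (hD₁ : IsOfFSMFFType D₁) (hD₂ : IsOfFSMFFType D₂) (hsl₁ : IsSlim D₁) (hsl₂ : IsSlim D₂)
    (Ψ : d₁.frobenioid ≌ d₂.frobenioid) :
    ∃ (ΨBase : D₁ ⥤ D₂)
      (E : DivisorMonoidIsoOverBase (ModelFrobenioid.data d₁.Φ d₁.B d₁.divB)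
        (ModelFrobenioid.data d₂.Φ d₂.B d₂.divB) ΨBase)
      (η : Ψ.functor ⋙ (ModelFrobenioid.data d₂.Φ d₂.B d₂.divB).base ≅
        (ModelFrobenioid.data d₁.Φ d₁.B d₁.divB).base ⋙ ΨBase),
      ΨBase.IsEquivalence ∧
        PreservesDegFr (ModelFrobenioid.data d₁.Φ d₁.B d₁.divB) (ModelFrobenioid.data d₂.Φ d₂.B d₂.divB) Ψ ∧
        (∀ ⦃A B : d₁.frobenioid⦄ (φ : A ⟶ B),
          (ModelFrobenioid.data d₂.Φ d₂.B d₂.divB).div (Ψ.functor.map φ) =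
            (ModelFrobenioid.data d₂.Φ d₂.B d₂.divB).pull (η.hom.app A)
              (E.iso ((ModelFrobenioid.data d₁.Φ d₁.B d₁.divB).base.obj A)
                ((ModelFrobenioid.data d₁.Φ d₁.B d₁.divB).div φ))) ∧
        (IsRigidFunctor (Ψ.functor ⋙ (ModelFrobenioid.data d₂.Φ d₂.B d₂.divB).base) ∧
          IsRigidFunctor ((ModelFrobenioid.data d₁.Φ d₁.B d₁.divB).base ⋙ ΨBase)) := by
  obtain ⟨ΨBase, E, η, hequiv, hdeg, hdiv, hrig⟩ := cor411iv_padic_of_isMonoidData d₁ d₂ h₁ h₂ Ψ _ _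
    (cor411Setting_padic_of_isOfFSMFFType d₁ d₂ hD₁ hD₂ hsl₁ hsl₂ Ψ)
    (d₁.isOfRationallyStandardType_rsParams h₁ hD₁) (d₂.isOfRationallyStandardType_rsParams h₂ hD₂)
  exact ⟨ΨBase, E, η, hequiv, hdeg, hdiv, hrig hsl₁ hsl₂⟩

/-! ### Corollary 4.11 (i) -/

/-- **[FrdI] Cor. 4.11 (i) for `p`-adic Frobenioids over slim bases of FSMFF-type with `Φ_i`, `B_i` monoids on
`D_i`**: for every `Ψ : C₁ ⥲ C₂` there is the restriction `Ψ^istr : C₁^istr ⥲ C₂^istr` (Thm. 3.4 (i)) together with a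
`1`-unique `Ψ^un-tr : C₁^un-tr ⥲ C₂^un-tr` `1`-commuting with the unit-trivializations, both composites rigid — the
typed `Cor411i` for `Ψ^istr` (`PreFrobenioid.cor411i_ofFunctor`, no base hypothesis, at
`cor411Setting_padic_of_isOfFSMFFType`). [cite: MochizukiFrdI2008, Cor. 4.11 (i) p.91]
[cite: MochizukiFrdII2008, Thm 1.2 (i) p.9] -/
theorem exists_cor411i_padic_of_isOfFSMFFType (h₁ : d₁.IsMonoidData) (h₂ : d₂.IsMonoidData)
    (hD₁ : IsOfFSMFFType D₁) (hD₂ : IsOfFSMFFType D₂) (hsl₁ : IsSlim D₁) (hsl₂ : IsSlim D₂)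
    (Ψ : d₁.frobenioid ≌ d₂.frobenioid) :
    ∃ Ψistr : (ModelFrobenioid.data d₁.Φ d₁.B d₁.divB).Istr ≌ (ModelFrobenioid.data d₂.Φ d₂.B d₂.divB).Istr,
      Ψistr.functor ⋙ (ModelFrobenioid.data d₂.Φ d₂.B d₂.divB).istrι =
          (ModelFrobenioid.data d₁.Φ d₁.B d₁.divB).istrι ⋙ Ψ.functor ∧
        (ModelFrobenioid.data d₁.Φ d₁.B d₁.divB).Cor411i (ModelFrobenioid.data d₂.Φ d₂.B d₂.divB) Ψ
          Ψistr.functor :=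
  cor411i_ofFunctor (d₁.isFrobenioid_of_isMonoidData h₁) (d₂.isFrobenioid_of_isMonoidData h₂)
    (padic_objectwise_isPerfFactorial d₁) (padic_objectwise_isPerfFactorial d₂) Ψ
    (cor411Setting_padic_of_isOfFSMFFType d₁ d₂ hD₁ hD₂ hsl₁ hsl₂ Ψ)

end PadicFrd

end Literature.AlgebraicGeometry.Frobenioids

end
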